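/-
Copyright: the b2b-balaban T⁴-continuum CRUX team, row NE7b OWNER lineage `t4-ne7b-p1` (gen 135). Project licence.
-/
import Summits.QuantumFields.BalabanUV.T4Continuum.Spine.NE7b.SupFineCellNextFactor

/-!
# THE LOCAL LETTER ON SPARSE UNIONS FROM FINITE RANGE — (d7′)(1′) IN THE ABSTRACT: for a covariance `Γ ⪰ 0` of range `ρ` (for the site
# distance `dι`) with entries `|Γ(x,y)| ≤ γ_∞`, and a SPARSE union `U = ⋃_{p∈S}c(p)` of fine cells (`c(p) ⊆ cell p`, `#c(p) ≤ v₀`) such that every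
# site `x` is within range of at most `N` of the big cells of `S` (`#{p ∈ S : ∃y ∈ cell p, dι(x,y) ≤ ρ} ≤ N` — for cubes of side `≥ ρ` on the torus
# `N = 3^d`, (366)), the row sums of `Γ` on `U` are `≤ N·v₀·γ_∞`, hence ((378)'s Schur block test)
#   `(N·v₀·γ_∞)·1 − Γ|_U ⪰ 0`:
# the LOCAL operator-norm letter `γ₂ = N·v₀·γ_∞` for the conversion rate of (378)–(382) — a quantity of the size of ONE finest cell's block
# (`v₀·sup|Γ_j| ≍ v₀·4^{−j}` for the lineage's `d = 4` shells), NOT the shell's global operator norm (`≍ 4^{j}`): the margin `2κ₂γ₂ ≤ θ` lets the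
# conversion rate GROW like `4^j` along the scales, so (376)'s window decrements `√(2κ₂⁻¹log)` are SUMMABLE and the small-field radii `h_j` decrease
# to a positive limit (row NE7b, node U5c; (378) BY NAME; [folklore])

Cell `pub-balaban`, sub-cell `t4`, spine estimate NE7b (`T4WeightBudget.RelWeightBound`; the cell's OWN estimate — NOT PRINTED in
[Bałaban 1983–89], NOT PROVED).  Crux-route work under `Spine/NE7b/` by the row OWNER (`t4-ne7b-p1` gen 135, file (383)) under FREEZE
(0)'s crux-prover clause, on this gen's SCOPING-d7 DECISION (d7′)(1′); NOTHING of Bałaban's is named as a Lean object, valued or asserted; no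
`T4Continuum/Support` leaf typed; no `def`, no notation; zero `sorry`.  Imports (BY NAME): the OWNER's (378) `…SupFineCellRegulator`
(`local_opNorm_of_rowSum`; via (381)), (379) `…SupFineCellActivityBound` (`choice_pairwiseDisjoint`), the tree's
`Literature.Analysis.Matrix.HasFiniteRange`; Mathlib's `Finset.sum_biUnion`, `Finset.sum_le_card_nsmul`, `Finset.card_attach`.

WHAT IS PROVED ([folklore]):
* §1 `rowSum_cell_le` (one fine cell: `Σ_{y∈c}|Γ(x,y)| ≤ v₀γ_∞`), `rowSum_cell_eq_zero_of_far` (a big cell out of range of `x` contributes `0`),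
  **`rowSum_sparse_le`** (`Σ_{y∈U}|Γ(x,y)| ≤ N·v₀·γ_∞` for every site `x`);
* §2 THE END **`local_letter_sparse`** (`(N·v₀·γ_∞)·1 − Γ|_U ⪰ 0` in exactly the dependent-choice shape consumed by (379)∕(380)∕(381)∕(382)'s `hloc`);
  §3 toy.

HONEST (what this is NOT).  The geometric count `N` is a hypothesis (for the lineage's torus cubes `N = 3^d` by (366)'s `card_linfNbr_le` once
the big cells have side `≥ ρ_j` — one more bookkeeping line for the successor); the entry letter `γ_∞` for the shells is (284)'s; (d7′)(2′) (the
stability rate along the scales = quadratic extraction) untouched; scalar skeleton ((A3), NC-NE7b-α UNRULED); nothing of Bałaban's asserted.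
BY-NAME EFFECT ON THE WALL: NONE.  NE7b NOT PRINTED ∕ NOT PROVED; spine PROVED 0∕9; rung (B)+1 — the programme's measures remain FINITE-torus
statements; NOT the mass gap, NOT Clay.  HONEST DEPENDENCY: continuum YM on T⁴ ⇐ BetaPertH ∧ nine spine estimates (0∕9 proved); BetaPertH ⇐
(D1) ∧ (D4) ∧ CAP+tail; G-an2-4 gates asym, D1 and NE2∕3∕4.
-/

set_option autoImplicit false

noncomputable section

namespace Summit.QuantumFields.BalabanUV.T4Continuum.NE7b.SupSparseUnionLetter

open Matrix Real Finset
open scoped BigOperators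
open Literature.Analysis.Matrix (HasFiniteRange)
open SupFineCellRegulator (local_opNorm_of_rowSum)
open SupFineCellActivityBound (choice_pairwiseDisjoint)

variable {ι : Type} [Fintype ι] [DecidableEq ι] {V : Type*} [DecidableEq V]

/-! ## §1. Row sums on sparse unions -/

omit [Fintype ι] [DecidableEq ι] [DecidableEq V] in
/-- One fine cell of `≤ v₀` sites: `Σ_{y∈c}|Γ(x,y)| ≤ v₀·γ_∞`. [folklore] -/
theorem rowSum_cell_le (Γ : Matrix ι ι ℝ) {γinf : ℝ} (hsup : ∀ x y, |Γ x y| ≤ γinf) {c : Finset ι} {v₀ : ℕ} (hc : c.card ≤ v₀) (x : ι) :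
    ∑ y ∈ c, |Γ x y| ≤ v₀ * γinf := by
  have hγ : 0 ≤ γinf := le_trans (abs_nonneg _) (hsup x x)
  calc ∑ y ∈ c, |Γ x y| ≤ ∑ _y ∈ c, γinf := sum_le_sum fun y _ => hsup x y
    _ = c.card * γinf := by rw [sum_const, nsmul_eq_mul]
    _ ≤ v₀ * γinf := mul_le_mul_of_nonneg_right (by exact_mod_cast hc) hγ

omit [Fintype ι] [DecidableEq ι] [DecidableEq V] in
/-- **A big cell out of range of `x` contributes nothing** (finite range: `Γ(x,y) = 0` when `dι(x,y) > ρ`). [folklore] -/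
theorem rowSum_cell_eq_zero_of_far {Γ : Matrix ι ι ℝ} {dι : ι → ι → ℕ} {ρ : ℕ} (hfr : HasFiniteRange dι ρ Γ) (cell : V → Finset ι) {p : V}
    {c : Finset ι} (hc : c ⊆ cell p) (x : ι) (hfar : ¬ ∃ y ∈ cell p, dι x y ≤ ρ) : ∑ y ∈ c, |Γ x y| = 0 := by
  refine sum_eq_zero fun y hy => ?_
  have hxy : ρ < dι x y := not_le.1 fun hle => hfar ⟨y, hc hy, hle⟩
  rw [hfr x y hxy, abs_zero]

omit [Fintype ι] in
/-- **ROW SUMS ON A SPARSE UNION**: `Γ` of range `ρ` with `|Γ(x,y)| ≤ γ_∞`; disjoint big cells; one fine cell `c(p) ⊆ cell p` of `≤ v₀` sites per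
`p ∈ S`; every site within range of at most `N` big cells of `S` ⟹ `Σ_{y ∈ ⋃_p c(p)}|Γ(x,y)| ≤ N·v₀·γ_∞` for every `x`. [folklore] -/
theorem rowSum_sparse_le {Γ : Matrix ι ι ℝ} {dι : ι → ι → ℕ} {ρ : ℕ} (hfr : HasFiniteRange dι ρ Γ) {γinf : ℝ} (hsup : ∀ x y, |Γ x y| ≤ γinf)
    (cell : V → Finset ι) (hdisj : ∀ p q, p ≠ q → Disjoint (cell p) (cell q)) (fine : V → Finset (Finset ι))
    (hfine : ∀ p, ∀ c ∈ fine p, c ⊆ cell p) {v₀ : ℕ} (hv₀ : ∀ p, ∀ c ∈ fine p, c.card ≤ v₀) (S : Finset V) (c : ∀ p ∈ S, Finset ι)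
    (hcS : ∀ p (hp : p ∈ S), c p hp ∈ fine p) {N : ℕ} (hN : ∀ x : ι, (S.filter fun p => ∃ y ∈ cell p, dι x y ≤ ρ).card ≤ N) (x : ι) :
    ∑ y ∈ S.attach.biUnion (fun p => c p.1 p.2), |Γ x y| ≤ N * (v₀ * γinf) := by
  have hγ : 0 ≤ γinf := le_trans (abs_nonneg _) (hsup x x)
  have hpd := choice_pairwiseDisjoint cell hdisj fine hfine S c hcS
  rw [sum_biUnion hpd]
  -- split the big cells of `S` into those within range of `x` and the others (which contribute `0`)
  rw [← sum_filter_add_sum_filter_not S.attach (fun p => ∃ y ∈ cell p.1, dι x y ≤ ρ)]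
  have hfar : ∑ p ∈ S.attach with ¬ (∃ y ∈ cell p.1, dι x y ≤ ρ), ∑ y ∈ c p.1 p.2, |Γ x y| = 0 :=
    sum_eq_zero fun p hp => rowSum_cell_eq_zero_of_far hfr cell (hfine p.1 _ (hcS p.1 p.2)) x (mem_filter.1 hp).2
  rw [hfar, add_zero]
  calc ∑ p ∈ S.attach with (∃ y ∈ cell p.1, dι x y ≤ ρ), ∑ y ∈ c p.1 p.2, |Γ x y|
      ≤ ∑ p ∈ S.attach with (∃ y ∈ cell p.1, dι x y ≤ ρ), (v₀ * γinf) :=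
        sum_le_sum fun p _ => rowSum_cell_le Γ hsup (hv₀ p.1 _ (hcS p.1 p.2)) x
    _ = (S.attach.filter fun p => ∃ y ∈ cell p.1, dι x y ≤ ρ).card * (v₀ * γinf) := by rw [sum_const, nsmul_eq_mul]
    _ ≤ N * (v₀ * γinf) := by
        refine mul_le_mul_of_nonneg_right ?_ (by positivity)
        have hcard : (S.attach.filter fun p => ∃ y ∈ cell p.1, dι x y ≤ ρ).card ≤ (S.filter fun p => ∃ y ∈ cell p, dι x y ≤ ρ).card := by
          calc (S.attach.filter fun p => ∃ y ∈ cell p.1, dι x y ≤ ρ).card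
              = ((S.attach.filter fun p => ∃ y ∈ cell p.1, dι x y ≤ ρ).image fun p => p.1).card :=
                (card_image_of_injective _ fun p q h => Subtype.ext h).symm
            _ ≤ (S.filter fun p => ∃ y ∈ cell p, dι x y ≤ ρ).card := by
                refine card_le_card fun q hq => ?_
                obtain ⟨p, hp, rfl⟩ := mem_image.1 hq
                exact mem_filter.2 ⟨p.2, (mem_filter.1 hp).2⟩
        exact_mod_cast hcard.trans (hN x)

/-! ## §2. THE END: the local letter on sparse unions -/

omit [Fintype ι] in
/-- **THE LOCAL LETTER ON SPARSE UNIONS FROM FINITE RANGE**: `Γ ⪰ 0` of range `ρ` with `|Γ(x,y)| ≤ γ_∞`; disjoint big cells with fine families;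
every site within range of at most `N` big cells of `S` ⟹ for every choice `c` of one fine cell per big cell of `S`:
`(N·v₀·γ_∞)·1 − Γ|_{⋃_p c(p)} ⪰ 0` — the `hloc` of (379)–(382). [folklore] -/
theorem local_letter_sparse {Γ : Matrix ι ι ℝ} (hΓ : Γ.PosSemidef) {dι : ι → ι → ℕ} {ρ : ℕ} (hfr : HasFiniteRange dι ρ Γ) {γinf : ℝ}
    (hsup : ∀ x y, |Γ x y| ≤ γinf) (cell : V → Finset ι) (hdisj : ∀ p q, p ≠ q → Disjoint (cell p) (cell q))
    (fine : V → Finset (Finset ι)) (hfine : ∀ p, ∀ c ∈ fine p, c ⊆ cell p) {v₀ : ℕ} (hv₀ : ∀ p, ∀ c ∈ fine p, c.card ≤ v₀) {N : ℕ}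
    (S : Finset V) (hN : ∀ x : ι, (S.filter fun p => ∃ y ∈ cell p, dι x y ≤ ρ).card ≤ N) (c : ∀ p ∈ S, Finset ι)
    (hcS : ∀ p (hp : p ∈ S), c p hp ∈ fine p) :
    ((N * (v₀ * γinf)) • (1 : Matrix (S.attach.biUnion fun p => c p.1 p.2) (S.attach.biUnion fun p => c p.1 p.2) ℝ) -
      Γ.submatrix (fun e : (S.attach.biUnion fun p => c p.1 p.2) => (e : ι))
        (fun e : (S.attach.biUnion fun p => c p.1 p.2) => (e : ι))).PosSemidef :=
  local_opNorm_of_rowSum hΓ _ fun x _ => rowSum_sparse_le hfr hsup cell hdisj fine hfine hv₀ S c hcS hN x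

/-! ## §3. Toy -/

omit [Fintype ι] [DecidableEq ι] [DecidableEq V] in
/-- Toy (§1): the empty fine cell has row sum `0 ≤ 0·γ_∞`. -/
example (Γ : Matrix ι ι ℝ) {γinf : ℝ} (hsup : ∀ x y, |Γ x y| ≤ γinf) (x : ι) : ∑ y ∈ (∅ : Finset ι), |Γ x y| ≤ (0 : ℕ) * γinf :=
  rowSum_cell_le Γ hsup (c := ∅) (by simp) x

end Summit.QuantumFields.BalabanUV.T4Continuum.NE7b.SupSparseUnionLetter
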